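import Summits.CriticalPhenomena.PercolationContinuityZ3.Theorems.PercNearOneGluingNoHeavyLowerTailThreePointPiecesTwoHubs
import HarnessLib

/-!
# The piece calculus for TWO-HUB pieces, II: the cylinder isolation coordinates are affine in the interior weight
# (Sahi programme, prover prim-sahi-p2 gen 46)

Support file (`--supports stmt-CriticalPhenomena-4575`, helper), continuing `…ThreePointPiecesTwoHubs` (`isoPiece_twoHub_iff`,
`real_mergedIso`, `real_mergedBoth`).  No definitions, no named facts, no sorries; standard axioms.
* `isoPiece_twoHub_eq`, `sepPiece_twoHub_eq` [this work] — set forms: on `{h₁h₂ open}` the isolation / separation events of the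
  piece are the merged-hub events, on `{h₁h₂ closed}` they are the intersections of the two single-hub events `isoH` of
  `ThreePointHubEvents`.
* `real_isoPiece_twoHub` [this work] — with `λ = w(h₁h₂)`:
  `μ(x separated from y, z inside the piece) = λ·(1 − (1−(1−x₁)(1−x₂))(1 − (1−y₁)(1−z₁)(1−y₂)(1−z₂))) + (1−λ)·∏ⱼ (1 − xⱼ(1 − (1−yⱼ)(1−zⱼ)))`
  (peel the interior coordinate, `OneLayerTwoFinger.real_inter_mem/notMem`; independence of the two hubs' star pairs; `real_isoH`).
* `real_sepPiece_twoHub` [this work] — the same for "all three terminals separated inside the piece", by inclusion–exclusion on the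
  merged side (as in `real_sepH`) and `real_sepH` twice on the product side.
These are exactly the affine-in-`λ` isolation coordinates `(1−λ)·(hub₁ ⊙ hub₂) + λ·(merged hub)` of `…ThreePointHalvingTwoHubPiece`
(`HalvingTwoHub.twoHubPair_halving`); `…ThreePointHalvingSmallPieces` assembles the halving lemma (v) from them.
-/

namespace Summit.CriticalPhenomena.PercolationContinuityZ3.Theorems.ThreePointPiecesTwoHub

open MeasureTheory Set
open Literature.Probability.Percolation Literature.Probability.LatticeModels
open Summit.CriticalPhenomena.PercolationContinuityZ3.Theorems.ThreePointPieces
open Summit.CriticalPhenomena.PercolationContinuityZ3.Theorems.ThreePointHubEvents (isoH determinedBy_of_iff determinedBy_isoH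
  real_isoH real_sepH)

variable {V : Type*} [Fintype V] [DecidableEq V] {ι : Type*} [DecidableEq ι]

/-! ## The cylinder isolation coordinates of a two-hub piece -/

section pieceProb
variable (w : Sym2 V → unitInterval) {a b c : V} {part : V → ι} {i : ι} {h₁ h₂ : V}

omit [Fintype V] [DecidableEq V] in
/-- A star pair of `h₁` is not the interior pair. [folklore] -/
theorem starPair_ne_inner₁ {p : V} (h1p : h₁ ≠ p) (h2p : h₂ ≠ p) : s(p, h₁) ≠ s(h₁, h₂) := by
  intro e
  rcases Sym2.eq_iff.1 e with ⟨e1, -⟩ | ⟨e1, -⟩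
  · exact h1p e1.symm
  · exact h2p e1.symm

omit [Fintype V] [DecidableEq V] in
/-- A star pair of `h₂` is not the interior pair. [folklore] -/
theorem starPair_ne_inner₂ {p : V} (h1p : h₁ ≠ p) (h2p : h₂ ≠ p) : s(p, h₂) ≠ s(h₁, h₂) := by
  intro e
  rcases Sym2.eq_iff.1 e with ⟨e1, -⟩ | ⟨e1, -⟩
  · exact h1p e1.symm
  · exact h2p e1.symm

/-- **Set form of two-hub isolation**: condition on the interior pair. [this work] -/
theorem isoPiece_twoHub_eq (h12 : h₁ ≠ h₂) (hh₁ : h₁ ∉ terms a b c) (hh₂ : h₂ ∉ terms a b c) (hi₁ : part h₁ = i) (hi₂ : part h₂ = i)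
    (hi : ∀ v, v ∉ terms a b c → part v = i → v = h₁ ∨ v = h₂) {x y z : V} (hT : ∀ v, v ∈ terms a b c → v = x ∨ v = y ∨ v = z)
    (hx : x ∈ terms a b c) (hy : y ∈ terms a b c) (hz : z ∈ terms a b c) (hxy : x ≠ y) (hxz : x ≠ z) :
    isoPiece (piecePairs a b c part i) x y z =
      ({ω | s(h₁, h₂) ∈ ω} ∩ {ω | ¬ ((s(x, h₁) ∈ ω ∨ s(x, h₂) ∈ ω) ∧
          (s(y, h₁) ∈ ω ∨ s(z, h₁) ∈ ω ∨ s(y, h₂) ∈ ω ∨ s(z, h₂) ∈ ω))}) ∪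
        ({ω | s(h₁, h₂) ∉ ω} ∩ (isoH x y z h₁ ∩ isoH x y z h₂)) := by
  ext ω
  rw [isoPiece_twoHub_iff h12 hh₁ hh₂ hi₁ hi₂ hi hT hx hy hz hxy hxz]
  simp only [isoH, mem_setOf_eq, mem_inter_iff, mem_union]
  by_cases hL : s(h₁, h₂) ∈ ω
  · simp only [hL, true_and, not_true_eq_false, false_and, or_false]; tauto
  · simp only [hL, false_and, or_false, not_false_eq_true, true_and, false_or]; tauto

/-- **The `A/B/C`-coordinate of a two-hub piece.**  With `λ = w(h₁h₂)`, `xⱼ = w(x hⱼ)`, `yⱼ = w(y hⱼ)`, `zⱼ = w(z hⱼ)`: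
`μ(x separated from y, z inside the piece) = λ·(1 − (1−(1−x₁)(1−x₂))·(1 − (1−y₁)(1−z₁)(1−y₂)(1−z₂))) + (1−λ)·∏ⱼ (1 − xⱼ(1 − (1−yⱼ)(1−zⱼ)))`
— the merged hub versus the product of the two hubs. [this work] -/
theorem real_isoPiece_twoHub (h12 : h₁ ≠ h₂) (hh₁ : h₁ ∉ terms a b c) (hh₂ : h₂ ∉ terms a b c) (hi₁ : part h₁ = i) (hi₂ : part h₂ = i)
    (hi : ∀ v, v ∉ terms a b c → part v = i → v = h₁ ∨ v = h₂) {x y z : V} (hT : ∀ v, v ∈ terms a b c → v = x ∨ v = y ∨ v = z)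
    (hx : x ∈ terms a b c) (hy : y ∈ terms a b c) (hz : z ∈ terms a b c) (hxy : x ≠ y) (hxz : x ≠ z) (hyz : y ≠ z) :
    (prodBernoulli w).real (isoPiece (piecePairs a b c part i) x y z) =
      (w s(h₁, h₂) : ℝ) * (1 - (1 - (1 - (w s(x, h₁) : ℝ)) * (1 - (w s(x, h₂) : ℝ))) *
          (1 - (1 - (w s(y, h₁) : ℝ)) * (1 - (w s(z, h₁) : ℝ)) * ((1 - (w s(y, h₂) : ℝ)) * (1 - (w s(z, h₂) : ℝ))))) +
        (1 - (w s(h₁, h₂) : ℝ)) * ((1 - (w s(x, h₁) : ℝ) * (1 - (1 - (w s(y, h₁) : ℝ)) * (1 - (w s(z, h₁) : ℝ)))) *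
          (1 - (w s(x, h₂) : ℝ) * (1 - (1 - (w s(y, h₂) : ℝ)) * (1 - (w s(z, h₂) : ℝ))))) := by
  have h1x : h₁ ≠ x := fun e => hh₁ (e ▸ hx)
  have h2x : h₂ ≠ x := fun e => hh₂ (e ▸ hx)
  have h1y : h₁ ≠ y := fun e => hh₁ (e ▸ hy)
  have h2y : h₂ ≠ y := fun e => hh₂ (e ▸ hy)
  have h1z : h₁ ≠ z := fun e => hh₁ (e ▸ hz)
  have h2z : h₂ ≠ z := fun e => hh₂ (e ▸ hz)
  set M : Set (BondConfig V) := {ω | ¬ ((s(x, h₁) ∈ ω ∨ s(x, h₂) ∈ ω) ∧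
      (s(y, h₁) ∈ ω ∨ s(z, h₁) ∈ ω ∨ s(y, h₂) ∈ ω ∨ s(z, h₂) ∈ ω))} with hM
  set I12 : Set (BondConfig V) := isoH x y z h₁ ∩ isoH x y z h₂ with hI12
  set S6 : Finset (Sym2 V) := {s(x, h₁), s(x, h₂), s(y, h₁), s(z, h₁), s(y, h₂), s(z, h₂)} with hS6def
  have hS6 : (↑S6 : Set (Sym2 V)) ⊆ ({s(h₁, h₂)} : Set (Sym2 V))ᶜ := by
    intro e he
    simp only [hS6def, Finset.coe_insert, Finset.coe_singleton, mem_insert_iff, mem_singleton_iff] at he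
    rw [mem_compl_singleton_iff]
    rcases he with rfl | rfl | rfl | rfl | rfl | rfl
    · exact starPair_ne_inner₁ h1x h2x
    · exact starPair_ne_inner₂ h1x h2x
    · exact starPair_ne_inner₁ h1y h2y
    · exact starPair_ne_inner₁ h1z h2z
    · exact starPair_ne_inner₂ h1y h2y
    · exact starPair_ne_inner₂ h1z h2z
  have hMd : DeterminedBy M ({s(h₁, h₂)} : Set (Sym2 V))ᶜ := by
    refine (determinedBy_of_iff (F := S6) fun ω ω' hF => ?_).mono hS6
    simp only [hM, mem_setOf_eq, hF _ (by simp [hS6def] : s(x, h₁) ∈ S6), hF _ (by simp [hS6def] : s(x, h₂) ∈ S6),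
      hF _ (by simp [hS6def] : s(y, h₁) ∈ S6), hF _ (by simp [hS6def] : s(z, h₁) ∈ S6), hF _ (by simp [hS6def] : s(y, h₂) ∈ S6),
      hF _ (by simp [hS6def] : s(z, h₂) ∈ S6)]
  have hI1d : DeterminedBy (isoH x y z h₁) (↑(ThreePointHubEvents.starPairs x y z h₁) : Set (Sym2 V)) :=
    determinedBy_isoH (by simp [ThreePointHubEvents.starPairs]) (by simp [ThreePointHubEvents.starPairs])
      (by simp [ThreePointHubEvents.starPairs])
  have hI2d : DeterminedBy (isoH x y z h₂) (↑(ThreePointHubEvents.starPairs x y z h₂) : Set (Sym2 V)) :=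
    determinedBy_isoH (by simp [ThreePointHubEvents.starPairs]) (by simp [ThreePointHubEvents.starPairs])
      (by simp [ThreePointHubEvents.starPairs])
  have hsub : ∀ {h : V}, h = h₁ ∨ h = h₂ → (↑(ThreePointHubEvents.starPairs x y z h) : Set (Sym2 V)) ⊆ ({s(h₁, h₂)} : Set (Sym2 V))ᶜ := by
    rintro h hh e he
    simp only [ThreePointHubEvents.starPairs, Finset.coe_insert, Finset.coe_singleton, mem_insert_iff, mem_singleton_iff] at he
    rw [mem_compl_singleton_iff]
    rcases hh with rfl | rfl
    · rcases he with rfl | rfl | rfl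
      · exact starPair_ne_inner₁ h1x h2x
      · exact starPair_ne_inner₁ h1y h2y
      · exact starPair_ne_inner₁ h1z h2z
    · rcases he with rfl | rfl | rfl
      · exact starPair_ne_inner₂ h1x h2x
      · exact starPair_ne_inner₂ h1y h2y
      · exact starPair_ne_inner₂ h1z h2z
  have hI12d : DeterminedBy I12 ({s(h₁, h₂)} : Set (Sym2 V))ᶜ := (hI1d.mono (hsub (Or.inl rfl))).inter (hI2d.mono (hsub (Or.inr rfl)))
  have hdisjH : Disjoint (ThreePointHubEvents.starPairs x y z h₁) (ThreePointHubEvents.starPairs x y z h₂) :=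
    ThreePointHubEvents.pairwiseDisjoint_starPairs x y z (Finset.mem_coe.2 (ThreePointHubEvents.mem_hubs.2 ⟨h1x, h1y, h1z⟩))
      (Finset.mem_coe.2 (ThreePointHubEvents.mem_hubs.2 ⟨h2x, h2y, h2z⟩)) h12
  have rI12 : (prodBernoulli w).real I12 = (prodBernoulli w).real (isoH x y z h₁) * (prodBernoulli w).real (isoH x y z h₂) :=
    prodBernoulli_real_inter_of_determinedBy_disjoint w hdisjH hI1d hI2d MeasurableSet.of_discrete MeasurableSet.of_discrete
  have hdj : Disjoint ({ω : BondConfig V | s(h₁, h₂) ∈ ω} ∩ M) ({ω : BondConfig V | s(h₁, h₂) ∉ ω} ∩ I12) :=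
    Set.disjoint_left.2 fun ω hω hω' => hω'.1 hω.1
  rw [isoPiece_twoHub_eq h12 hh₁ hh₂ hi₁ hi₂ hi hT hx hy hz hxy hxz, measureReal_union hdj MeasurableSet.of_discrete,
    Set.inter_comm _ M, Set.inter_comm _ I12, OneLayerTwoFinger.real_inter_mem w _ hMd, OneLayerTwoFinger.real_inter_notMem w _ hI12d,
    rI12, real_isoH w hxy hxz hyz, real_isoH w hxy hxz hyz, hM, real_mergedIso w hxy hxz hyz h12 h1x h2x h2y h2z]
  ring

/-- **Set form of two-hub separation** ("all three terminals separated inside the piece"), conditioned on the interior pair. [this work] -/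
theorem sepPiece_twoHub_eq (hab : a ≠ b) (hac : a ≠ c) (hbc : b ≠ c) (h12 : h₁ ≠ h₂) (hh₁ : h₁ ∉ terms a b c) (hh₂ : h₂ ∉ terms a b c)
    (hi₁ : part h₁ = i) (hi₂ : part h₂ = i) (hi : ∀ v, v ∉ terms a b c → part v = i → v = h₁ ∨ v = h₂) :
    isoPiece (piecePairs a b c part i) a b c ∩ isoPiece (piecePairs a b c part i) b a c =
      ({ω | s(h₁, h₂) ∈ ω} ∩ ({ω | ¬ ((s(a, h₁) ∈ ω ∨ s(a, h₂) ∈ ω) ∧ (s(b, h₁) ∈ ω ∨ s(c, h₁) ∈ ω ∨ s(b, h₂) ∈ ω ∨ s(c, h₂) ∈ ω))} ∩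
          {ω | ¬ ((s(b, h₁) ∈ ω ∨ s(b, h₂) ∈ ω) ∧ (s(a, h₁) ∈ ω ∨ s(c, h₁) ∈ ω ∨ s(a, h₂) ∈ ω ∨ s(c, h₂) ∈ ω))})) ∪
        ({ω | s(h₁, h₂) ∉ ω} ∩ ((isoH a b c h₁ ∩ isoH b a c h₁) ∩ (isoH a b c h₂ ∩ isoH b a c h₂))) := by
  have ha : a ∈ terms a b c := mem_terms.2 (Or.inl rfl)
  have hb : b ∈ terms a b c := mem_terms.2 (Or.inr (Or.inl rfl))
  have hc : c ∈ terms a b c := mem_terms.2 (Or.inr (Or.inr rfl))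
  have hTa : ∀ v, v ∈ terms a b c → v = a ∨ v = b ∨ v = c := fun v hv => mem_terms.1 hv
  have hTb : ∀ v, v ∈ terms a b c → v = b ∨ v = a ∨ v = c := fun v hv => by
    rcases mem_terms.1 hv with h | h | h
    · exact Or.inr (Or.inl h)
    · exact Or.inl h
    · exact Or.inr (Or.inr h)
  rw [isoPiece_twoHub_eq h12 hh₁ hh₂ hi₁ hi₂ hi hTa ha hb hc hab hac, isoPiece_twoHub_eq h12 hh₁ hh₂ hi₁ hi₂ hi hTb hb ha hc (Ne.symm hab) hbc]
  ext ω
  simp only [isoH, mem_setOf_eq, mem_inter_iff, mem_union]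
  by_cases hL : s(h₁, h₂) ∈ ω
  · simp only [hL, true_and, not_true_eq_false, false_and, or_false]
  · simp only [hL, false_and, not_false_eq_true, true_and, false_or]; tauto

/-- **The `q`-coordinate of a two-hub piece** (all three terminals separated inside the piece).  With `λ = w(h₁h₂)`, `aⱼ = w(a hⱼ)` etc.:
`λ·[μ(M_a) + μ(M_b) − (1 − μ(both))] + (1−λ)·∏ⱼ (1 − aⱼbⱼ − aⱼcⱼ − bⱼcⱼ + 2aⱼbⱼcⱼ)` with the merged-hub values of `real_mergedIso`,
`real_mergedBoth` (inclusion–exclusion as in `real_sepH`) — equal to `(1−λ)·q(hub₁)q(hub₂) + λ·q(merged hub)`. [this work] -/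
theorem real_sepPiece_twoHub (hab : a ≠ b) (hac : a ≠ c) (hbc : b ≠ c) (h12 : h₁ ≠ h₂) (hh₁ : h₁ ∉ terms a b c) (hh₂ : h₂ ∉ terms a b c)
    (hi₁ : part h₁ = i) (hi₂ : part h₂ = i) (hi : ∀ v, v ∉ terms a b c → part v = i → v = h₁ ∨ v = h₂) :
    (prodBernoulli w).real (isoPiece (piecePairs a b c part i) a b c ∩ isoPiece (piecePairs a b c part i) b a c) =
      (w s(h₁, h₂) : ℝ) *
          ((1 - (1 - (1 - (w s(a, h₁) : ℝ)) * (1 - (w s(a, h₂) : ℝ))) *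
              (1 - (1 - (w s(b, h₁) : ℝ)) * (1 - (w s(c, h₁) : ℝ)) * ((1 - (w s(b, h₂) : ℝ)) * (1 - (w s(c, h₂) : ℝ))))) +
            (1 - (1 - (1 - (w s(b, h₁) : ℝ)) * (1 - (w s(b, h₂) : ℝ))) *
              (1 - (1 - (w s(a, h₁) : ℝ)) * (1 - (w s(c, h₁) : ℝ)) * ((1 - (w s(a, h₂) : ℝ)) * (1 - (w s(c, h₂) : ℝ))))) -
            (1 - (1 - (1 - (w s(a, h₁) : ℝ)) * (1 - (w s(a, h₂) : ℝ))) * (1 - (1 - (w s(b, h₁) : ℝ)) * (1 - (w s(b, h₂) : ℝ))))) +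
        (1 - (w s(h₁, h₂) : ℝ)) *
          ((1 - (w s(a, h₁) : ℝ) * w s(b, h₁) - (w s(a, h₁) : ℝ) * w s(c, h₁) - (w s(b, h₁) : ℝ) * w s(c, h₁) +
              2 * (w s(a, h₁) : ℝ) * w s(b, h₁) * w s(c, h₁)) *
            (1 - (w s(a, h₂) : ℝ) * w s(b, h₂) - (w s(a, h₂) : ℝ) * w s(c, h₂) - (w s(b, h₂) : ℝ) * w s(c, h₂) +
              2 * (w s(a, h₂) : ℝ) * w s(b, h₂) * w s(c, h₂))) := by
  have h1a : h₁ ≠ a := fun e => hh₁ (e ▸ mem_terms.2 (Or.inl rfl))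
  have h2a : h₂ ≠ a := fun e => hh₂ (e ▸ mem_terms.2 (Or.inl rfl))
  have h1b : h₁ ≠ b := fun e => hh₁ (e ▸ mem_terms.2 (Or.inr (Or.inl rfl)))
  have h2b : h₂ ≠ b := fun e => hh₂ (e ▸ mem_terms.2 (Or.inr (Or.inl rfl)))
  have h1c : h₁ ≠ c := fun e => hh₁ (e ▸ mem_terms.2 (Or.inr (Or.inr rfl)))
  have h2c : h₂ ≠ c := fun e => hh₂ (e ▸ mem_terms.2 (Or.inr (Or.inr rfl)))
  set MA : Set (BondConfig V) := {ω | ¬ ((s(a, h₁) ∈ ω ∨ s(a, h₂) ∈ ω) ∧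
      (s(b, h₁) ∈ ω ∨ s(c, h₁) ∈ ω ∨ s(b, h₂) ∈ ω ∨ s(c, h₂) ∈ ω))} with hMA
  set MB : Set (BondConfig V) := {ω | ¬ ((s(b, h₁) ∈ ω ∨ s(b, h₂) ∈ ω) ∧
      (s(a, h₁) ∈ ω ∨ s(c, h₁) ∈ ω ∨ s(a, h₂) ∈ ω ∨ s(c, h₂) ∈ ω))} with hMB
  set J : Set (BondConfig V) := (isoH a b c h₁ ∩ isoH b a c h₁) ∩ (isoH a b c h₂ ∩ isoH b a c h₂) with hJ
  set S6 : Finset (Sym2 V) := {s(a, h₁), s(a, h₂), s(b, h₁), s(c, h₁), s(b, h₂), s(c, h₂)} with hS6def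
  have hS6 : (↑S6 : Set (Sym2 V)) ⊆ ({s(h₁, h₂)} : Set (Sym2 V))ᶜ := by
    intro e he
    simp only [hS6def, Finset.coe_insert, Finset.coe_singleton, mem_insert_iff, mem_singleton_iff] at he
    rw [mem_compl_singleton_iff]
    rcases he with rfl | rfl | rfl | rfl | rfl | rfl
    · exact starPair_ne_inner₁ h1a h2a
    · exact starPair_ne_inner₂ h1a h2a
    · exact starPair_ne_inner₁ h1b h2b
    · exact starPair_ne_inner₁ h1c h2c
    · exact starPair_ne_inner₂ h1b h2b
    · exact starPair_ne_inner₂ h1c h2c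
  have memS : s(a, h₁) ∈ S6 ∧ s(a, h₂) ∈ S6 ∧ s(b, h₁) ∈ S6 ∧ s(c, h₁) ∈ S6 ∧ s(b, h₂) ∈ S6 ∧ s(c, h₂) ∈ S6 := by
    simp [hS6def]
  obtain ⟨ma1, ma2, mb1, mc1, mb2, mc2⟩ := memS
  have hMAd : DeterminedBy MA (↑S6 : Set (Sym2 V)) := determinedBy_of_iff fun ω ω' hF => by
    simp only [hMA, mem_setOf_eq, hF _ ma1, hF _ ma2, hF _ mb1, hF _ mc1, hF _ mb2, hF _ mc2]
  have hMBd : DeterminedBy MB (↑S6 : Set (Sym2 V)) := determinedBy_of_iff fun ω ω' hF => by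
    simp only [hMB, mem_setOf_eq, hF _ ma1, hF _ ma2, hF _ mb1, hF _ mc1, hF _ mb2, hF _ mc2]
  have hMd : DeterminedBy (MA ∩ MB) ({s(h₁, h₂)} : Set (Sym2 V))ᶜ := (hMAd.inter hMBd).mono hS6
  have hJ1d : DeterminedBy (isoH a b c h₁ ∩ isoH b a c h₁) (↑(ThreePointHubEvents.starPairs a b c h₁) : Set (Sym2 V)) :=
    (determinedBy_isoH (by simp [ThreePointHubEvents.starPairs]) (by simp [ThreePointHubEvents.starPairs])
      (by simp [ThreePointHubEvents.starPairs])).inter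
      (determinedBy_isoH (by simp [ThreePointHubEvents.starPairs]) (by simp [ThreePointHubEvents.starPairs])
        (by simp [ThreePointHubEvents.starPairs]))
  have hJ2d : DeterminedBy (isoH a b c h₂ ∩ isoH b a c h₂) (↑(ThreePointHubEvents.starPairs a b c h₂) : Set (Sym2 V)) :=
    (determinedBy_isoH (by simp [ThreePointHubEvents.starPairs]) (by simp [ThreePointHubEvents.starPairs])
      (by simp [ThreePointHubEvents.starPairs])).inter
      (determinedBy_isoH (by simp [ThreePointHubEvents.starPairs]) (by simp [ThreePointHubEvents.starPairs])
        (by simp [ThreePointHubEvents.starPairs]))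
  have hsub : ∀ {h : V}, h = h₁ ∨ h = h₂ → (↑(ThreePointHubEvents.starPairs a b c h) : Set (Sym2 V)) ⊆ ({s(h₁, h₂)} : Set (Sym2 V))ᶜ := by
    rintro h hh e he
    simp only [ThreePointHubEvents.starPairs, Finset.coe_insert, Finset.coe_singleton, mem_insert_iff, mem_singleton_iff] at he
    rw [mem_compl_singleton_iff]
    rcases hh with rfl | rfl
    · rcases he with rfl | rfl | rfl
      · exact starPair_ne_inner₁ h1a h2a
      · exact starPair_ne_inner₁ h1b h2b
      · exact starPair_ne_inner₁ h1c h2c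
    · rcases he with rfl | rfl | rfl
      · exact starPair_ne_inner₂ h1a h2a
      · exact starPair_ne_inner₂ h1b h2b
      · exact starPair_ne_inner₂ h1c h2c
  have hJd : DeterminedBy J ({s(h₁, h₂)} : Set (Sym2 V))ᶜ := (hJ1d.mono (hsub (Or.inl rfl))).inter (hJ2d.mono (hsub (Or.inr rfl)))
  have hdisjH : Disjoint (ThreePointHubEvents.starPairs a b c h₁) (ThreePointHubEvents.starPairs a b c h₂) :=
    ThreePointHubEvents.pairwiseDisjoint_starPairs a b c (Finset.mem_coe.2 (ThreePointHubEvents.mem_hubs.2 ⟨h1a, h1b, h1c⟩))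
      (Finset.mem_coe.2 (ThreePointHubEvents.mem_hubs.2 ⟨h2a, h2b, h2c⟩)) h12
  have rJ : (prodBernoulli w).real J =
      (prodBernoulli w).real (isoH a b c h₁ ∩ isoH b a c h₁) * (prodBernoulli w).real (isoH a b c h₂ ∩ isoH b a c h₂) :=
    prodBernoulli_real_inter_of_determinedBy_disjoint w hdisjH hJ1d hJ2d MeasurableSet.of_discrete MeasurableSet.of_discrete
  -- inclusion–exclusion for the merged part
  have hU : MA ∪ MB = {ω : BondConfig V | (s(a, h₁) ∈ ω ∨ s(a, h₂) ∈ ω) ∧ (s(b, h₁) ∈ ω ∨ s(b, h₂) ∈ ω)}ᶜ := by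
    ext ω
    simp only [hMA, hMB, mem_union, mem_setOf_eq, mem_compl_iff]
    constructor
    · rintro (h | h) ⟨hA, hB⟩
      · exact h ⟨hA, hB.elim (fun h1 => Or.inl h1) fun h2 => Or.inr (Or.inr (Or.inl h2))⟩
      · exact h ⟨hB, hA.elim (fun h1 => Or.inl h1) fun h2 => Or.inr (Or.inr (Or.inl h2))⟩
    · intro h
      by_cases hA : s(a, h₁) ∈ ω ∨ s(a, h₂) ∈ ω
      · exact Or.inr fun hB => h ⟨hA, hB.1⟩
      · exact Or.inl fun hA' => hA hA'.1
  have rU : (prodBernoulli w).real (MA ∪ MB) =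
      1 - (1 - (1 - (w s(a, h₁) : ℝ)) * (1 - (w s(a, h₂) : ℝ))) * (1 - (1 - (w s(b, h₁) : ℝ)) * (1 - (w s(b, h₂) : ℝ))) := by
    rw [hU, probReal_compl_eq_one_sub MeasurableSet.of_discrete, real_mergedBoth w hab h12 h1a h2a h2b]
  have rMA : (prodBernoulli w).real MA = 1 - (1 - (1 - (w s(a, h₁) : ℝ)) * (1 - (w s(a, h₂) : ℝ))) *
      (1 - (1 - (w s(b, h₁) : ℝ)) * (1 - (w s(c, h₁) : ℝ)) * ((1 - (w s(b, h₂) : ℝ)) * (1 - (w s(c, h₂) : ℝ)))) :=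
    real_mergedIso w hab hac hbc h12 h1a h2a h2b h2c
  have rMB : (prodBernoulli w).real MB = 1 - (1 - (1 - (w s(b, h₁) : ℝ)) * (1 - (w s(b, h₂) : ℝ))) *
      (1 - (1 - (w s(a, h₁) : ℝ)) * (1 - (w s(c, h₁) : ℝ)) * ((1 - (w s(a, h₂) : ℝ)) * (1 - (w s(c, h₂) : ℝ)))) :=
    real_mergedIso w (Ne.symm hab) hbc hac h12 h1b h2b h2a h2c
  have hIE := measureReal_union_add_inter (μ := prodBernoulli w) (s := MA) (t := MB) MeasurableSet.of_discrete
  rw [rU, rMA, rMB] at hIE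
  have rI : (prodBernoulli w).real (MA ∩ MB) =
      (1 - (1 - (1 - (w s(a, h₁) : ℝ)) * (1 - (w s(a, h₂) : ℝ))) *
          (1 - (1 - (w s(b, h₁) : ℝ)) * (1 - (w s(c, h₁) : ℝ)) * ((1 - (w s(b, h₂) : ℝ)) * (1 - (w s(c, h₂) : ℝ))))) +
        (1 - (1 - (1 - (w s(b, h₁) : ℝ)) * (1 - (w s(b, h₂) : ℝ))) *
          (1 - (1 - (w s(a, h₁) : ℝ)) * (1 - (w s(c, h₁) : ℝ)) * ((1 - (w s(a, h₂) : ℝ)) * (1 - (w s(c, h₂) : ℝ))))) -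
        (1 - (1 - (1 - (w s(a, h₁) : ℝ)) * (1 - (w s(a, h₂) : ℝ))) * (1 - (1 - (w s(b, h₁) : ℝ)) * (1 - (w s(b, h₂) : ℝ)))) := by
    linarith [hIE]
  have hdj : Disjoint ({ω : BondConfig V | s(h₁, h₂) ∈ ω} ∩ (MA ∩ MB)) ({ω : BondConfig V | s(h₁, h₂) ∉ ω} ∩ J) :=
    Set.disjoint_left.2 fun ω hω hω' => hω'.1 hω.1
  rw [sepPiece_twoHub_eq hab hac hbc h12 hh₁ hh₂ hi₁ hi₂ hi, measureReal_union hdj MeasurableSet.of_discrete, Set.inter_comm _ (MA ∩ MB),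
    Set.inter_comm _ J, OneLayerTwoFinger.real_inter_mem w _ hMd, OneLayerTwoFinger.real_inter_notMem w _ hJd, rJ,
    real_sepH w hab hac hbc, real_sepH w hab hac hbc, rI]
  ring

end pieceProb

end Summit.CriticalPhenomena.PercolationContinuityZ3.Theorems.ThreePointPiecesTwoHub
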